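import Summits.QuantumFields.YangMills.Theorems.BalabanUVNodesN12AtTheta13OfThm1CCMWGenericDoorWindowGuard
import Summits.QuantumFields.YangMills.Theorems.BalabanUVNodesN12AtRecord13Prop1KnitThm1NearFlatLocOfRecord

/-!
# BalabanUVNodes ∕ N12 — THE WINDOW-GUARDED N12 SOCKET WITH EVERY LETTER OF THE LAYER AN OBJECT OF RECORD («12X»): 12Zᴳ-W §2 (`…GenericDoorWindowGuard`, p623526: `kSel := K − 1`, the
# (1.100) pin, the ΛΩχZ-pinned (1.89) setting, (1.89) DISCHARGED on NODE O's (2.7)-small window) ∘ 12Q⁸ (`…Prop1KnitThm1NearFlatLocOfRecord` §2, p619996: the Proposition-1 carrier PINNED to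
# print's (1.74) object `lfVarOn su2Chart (InstOn.std (bgMSCoPOfRecord …) …)` with Prop. 1 PROVED from dag-n12-c's J-C v1.2 endpoint letters) — so the supplier's last free letter `λ.LF`
# is gone: N12's displayed bill in the K1⁸ closers of record (dag-n24-w1 X3 (a) `…ChildrenSplitSlot8MixedW` p623152 ∕ dag-n24-c 42H `…Slot8MixedWExpNeg3`) consists of statements about
# OBJECTS OF RECORD only (Track A, DAG node N12 = [B15, Balaban1989LargeFieldI] CMP **122** (1989) 175–202; cluster K1 — K1⁹ `StabilityBRunRowsAtRecordR13SepCoPHV` = stmt-QuantumFields-27364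
# (route rev 28∕29; K1⁸ 26907 aside — the N12 binder text is edition-free), helper; seat `pub-ymgap-dag-n12-d` g17 (R134 s2 «knit at the record»), 2026-08-28; count-neutral, CONDITIONAL, NOT a discharge)

HONEST FRAMING.  Count-neutral kernel COMPOSITION BY NAME of two landed theorems of this seat; NO new estimate.  THE ONE THEOREM: at the generic door-cured window-edition witness
`θW = θ₁₅ᶜᶜᴹᵂ(j;γ;ε₀,ε₂₉;B₃,B₃',a₀,a₁)` with `γ ≤ e⁻³` and `1 ≤ j`, the window-guarded socket `∃ γ₁₂ > 0, ∃ lamW, ∀ P, lamW.kSel P < P.K → Step.InInterval γ₁₂ P.K (gOfRecord₁₃ F 2 θW P) →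
B15Leaf (WOfRecord₁₃ F 2 θW lamW P)` (the N12 binder of both K1⁸-by-name closers, this seat's ASK-2 text) witnessed by `γ₁₂ := γ` and the FULLY PINNED layer
`λˣ := ((({λ with kSel := K − 1, D1100 := the 𝐑-step's (1.100) reading, LF := fun P => lfVarOn su2Chart (fun i => InstOn.std (bgMSCoPOfRecord F 2 ν P.K (k P i) (maxDomT ν.M₁ (Z P i))) ν.M₁ (Z P i)
(Λ P i) (k P i) (M P i) (areg P i) (anExt …) (ext P i) (radius of record))}).pinRPrime₁₃ θW).pinD189ΛH ν A₁ M g σᶻ s Nm p₁)` — the radii `R P i` and thresholds `areg P i` PRODUCED inside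
(dag-n12-c's endpoint, `choose`), so NOTHING of `λ` is read except through these pins.  PROOF: `choose R areg` from dag-n12-c g17's
`B15Prop1EndpointNearFlatLetters.…_ofThm1TorusClass_ofMinimiserFamilyCompact_ofNearFlatLetters_sub_loc_oneSided` run by run (exactly 12Q⁸ §1's call at `ν := θW.ν`, [15] input = the door
letter `h15` via 12Q⁵ §0 `thm1TorusClass_of_variationalThm1RegSepCoP7M`, `hfar` by dag-n12-c's `far_letter_of_box`, `2 ≤ M₁ = L^j` from `1 ≤ j`, `εreg = a₀` by `rfl`), then 12Zᴳ-W §2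
`exists_gamma_residW_b15Leaf_window_theta13OfThm1CCMW_topLevel_pinnedΛΩχZ_of_massLive` at `λ := {λ with LF := the pin}` with its Prop-1 row fed (`fun P _ _ => hP P`).
WHICH CHILD BLOCKS (the kernel's list of what N12 costs in the K1⁸ closer of record at a door below e⁻³ — every item a statement about objects of record): per IN-WINDOW run with `1 ≤ K`:
positive mass of the LIVE pre-𝐑 terms at the top slot (NODE 00) · the levels `N₀(P) ≤ Nm P`, `N₀(P) ≤ K` · the base situation's residual numbers · the coupling-free p.200 letter `hC` + `hMl` ·
`β ≥ 0` along the history (NODE O's sign box) · `Λ ≠ ∅` · the four ℍ-leaves (1.91)ₕ∕(1.95)∕(1.91)∕(1.97) + (1.80) at `D P = λˣ.D189 P` (N07 ∕ dag-n12-e); per run and Prop-1 instance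
`i : ι P` (dag-n12-c ∕ the w-lineage's letters, verbatim from 12Q⁸ §2): (J0′) the compact-uniform configuration letter `hMinC`, (N) the localised near-flat letter package `hNF` with its
constants and `hsm`∕`hγle`, the geometry `hZ1` ∕ (Gᵃ) `hZblk` ∕ `hdiv`, `hk0`∕`hk`, the box data, `[Finite (ι P)]`, the bookkeeping constants `cE cA` with `heRa`∕`hcA`; door letters read:
`0 < γ ≤ ½`, `γ ≤ e⁻³`, `0 ≤ B₃`, `0 ≤ B₃'`, `0 < a₀`, `0 < a₁`, the upper box `hbox'` with `β'γ² ≤ ¾`, [15] Thm 1's sentence `h15`, and `1 ≤ j`.  Nothing of Bałaban's is asserted; every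
printed fact is a hypothesis; N12 is NOT discharged; no node is discharged; K0⁷ ∕ K1⁹ NOT closed; counts unmoved (discharged 5∕27 · Track A 5∕28).  ONE finite four-torus programme at fixed
`ε = L^{-K}` — nothing continuum ∕ ℝ⁴ ∕ OS ∕ mass gap ∕ Clay.  No `sorry`, `def`, `instance`, `notation`.

Sources: [Balaban1989LargeFieldI] (0.1)–(0.6) pp.175–176, (1.2) p.178, (1.74) p.192, p.193 ll.14–20, Prop. 1 (1.77)–(1.78) p.194, (1.79)–(1.80) p.195, (1.89) p.198, (1.91)–(1.97) pp.198–199,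
(1.99)–(1.102) pp.200–201; [Balaban1989LargeFieldII] (1.7)–(1.13) pp.358–359, (17)–(19) pp.360–361; [Balaban1988Convergent] (2.1)–(2.9) pp.254–256, (2.12)–(2.14) pp.256–257, (2.17)–(2.18)
p.257, (3.16)–(3.25) pp.268–270; [Balaban1985Variational] (1) p.277, (7) p.278, Thm 1 (8) p.279, Prop. 9 (190) p.309; [Balaban1985RegularSpaces] (1.3)–(1.9) p.77; [Balaban1987RG1] Thm 1 p.259,
(0.17)–(0.20) pp.255–256, §1 p.264.
-/

noncomputable section
open MeasureTheory Set Finset Metric Filter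
open scoped Matrix.Norms.L2Operator BigOperators Matrix RealInnerProductSpace Real InnerProductSpace Topology

namespace Summit.QuantumFields.YangMills.BalabanUVNodes.N12AtTheta13OfThm1CCMWGenericDoorWindowGuardPinLF

open Literature.MathematicalPhysics.QuantumFieldTheory.Balaban1983to89
open Literature.MathematicalPhysics.QuantumFieldTheory.Balaban1983to89.T4Continuum (T4Family)
open Literature.MathematicalPhysics.QuantumFieldTheory.Balaban1983to89.DagBinding
open Literature.MathematicalPhysics.QuantumFieldTheory.Balaban1983to89.Node00
open FlowStep (prefixOf BetaLowerH BetaUpperH)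
open B15Claim189Assembly (Setting189 new189 chiPP dom half)
open B15 (Prop1Printed Ineq180)
open B15.BasicStep (Claim189)
open B15.PrelimIntegrations (Ineq191 Ineq195)
open B15Chi124DetSets (E124)
open B14DomainGeom (Pt)
open B8Eq17ClassAkV1 (plaqsOf)
open GaugeGroup (dist1)
open GaugeField (plaqHol)
open B15Claim189PrintedConditions (omegaOfChain)
open B15Claim189PinsOfHistory (N0OfRecord₁₃)
open B15Claim189LambdaPin (enlD)
open B15RPrime1100OfRep (rPrimeDataOfSel)
open Summit.QuantumFields.YangMills.BalabanUVNodes.N12AtRecord13Prop1KnitThm1OfRecord (thm1TorusClass_of_variationalThm1RegSepCoP7M)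
open Summit.QuantumFields.YangMills.BalabanUVNodes.N12AtTheta13OfThm1CCMWGenericDoorWindowGuard (exists_gamma_residW_b15Leaf_window_theta13OfThm1CCMW_topLevel_pinnedΛΩχZ_of_massLive)
open T4CubeChartGnomonic (SU2)
open B15Prop1ChartSU2 (su2Chart)
open B15Prop1SliceCoordinates (GaugeSlice ιA)
open B15Prop1SliceTaylorCalculus (rGrad sliceFn)
open T4AxialGaugeSmallField (castSite boxPlaqs)
open B6BondElimination (unitVec)
open B6TreeGaugePoincare (curl)
open B16Eq18Proof (box)
open B15Extension193 (extend)
open B15ShellGauge193 (shellGauge)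
open B15Sect1Instances (fun177std)
open B14.Eq213DetSet (Bj maxDomT)
open Literature.MathematicalPhysics.QuantumFieldTheory.BalabanImbrieJaffe1984to88.BIJ85Eq453GaugeField (qsstarGIter0)
open B16Sect1Backgrounds (expMul)
open B15DeterminingSets (pts DetBackground genSet IsMinimizer MSField avgFamily)
open B15Prop1Carrier (lfVarOn InstOn InstOn.std plaqsInside)
open B15Prop1EndpointNearFlatLetters (exists_domain_prop1Printed_lfVarOn_std_su2_box_intrinsic_analytic_atZSeqCoPRecord_ofThm1TorusClass_ofMinimiserFamilyCompact_ofNearFlatLetters_sub_loc_oneSided)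
open T4AdjointCovarianceUnitary (lieSU)
open B15Prop1GradientFromNearValueAtCoPRecord (far_letter_of_box)
open B15Prop1AnalyticExtClause (cplxVec anExt)
open B15Prop1ChartCalculusSU2 (E3)

variable {F : T4Family}

section PinLF
variable {j : ℕ} {γ ε₀ ε₂₉ B₃ B₃' a₀ a₁ : ℝ} (lam : ResidW F 2) (σ : ∀ P : B12.RunParams, Sit189 F 2 P.K)
  (s : ∀ P : B12.RunParams, SeqOfRecord F (theta13OfThm1CCMW F 2 j γ ε₀ ε₂₉ B₃ B₃' a₀ a₁).ν (theta13OfThm1CCMW F 2 j γ ε₀ ε₂₉ B₃ B₃' a₀ a₁).τ9.M (gOfRecord₁₃ F 2 (theta13OfThm1CCMW F 2 j γ ε₀ ε₂₉ B₃ B₃' a₀ a₁) P) P.K (P.K - 1 + 1)) (Nm : B12.RunParams → ℕ) (p₁ : ℕ)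

/-- **★★★ THE WINDOW-GUARDED N12 SOCKET AT A DOOR BELOW `e⁻³`, EVERY LETTER OF THE LAYER AN OBJECT OF RECORD** — `∃ γ₁₂ > 0, ∃ lamW, ∀ P, lamW.kSel P < P.K →
Step.InInterval γ₁₂ P.K (gOfRecord₁₃ F 2 θW P) → B15Leaf (WOfRecord₁₃ F 2 θW lamW P)` with `γ₁₂ := γ` and the fully pinned layer `λˣ` (`kSel := K − 1`; (1.100) := the 𝐑-step's reading;
(1.89) setting := dag-n12-e's ΛΩχZ pin, displayed as `D P` by `hD`; Proposition-1 carrier := `lfVarOn su2Chart (InstOn.std (bgMSCoPOfRecord F 2 ν P.K (k P i) (maxDomT ν.M₁ (Z P i))) …)` at the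
radii ∕ thresholds PRODUCED by dag-n12-c's J-C v1.2 endpoint).  = 12Zᴳ-W §2 ∘ 12Q⁸: Prop. 1 (1.78) and Claim (1.89) are NOT displayed; displayed per in-window run with `1 ≤ K`: live-mass at the
top slot, the levels, the situation's residual numbers, `hC`, `hMl`, `hβhist`, `Λ ≠ ∅`, the four ℍ-leaves + (1.80) at `D P`; per run ∕ instance: dag-n12-c's (J0′) `hMinC`, (N) `hNF` + constants +
`hsm`∕`hγle`, `hZ1`, (Gᵃ) `hZblk`, `hdiv`, `hk0`∕`hk`, box data, `[Finite (ι P)]`, bookkeeping `cE cA`∕`heRa`∕`hcA`; door letters `hγ₀ hγh hB hB' ha₀ ha₁ hbox' hβ' hγe h15` + `1 ≤ j`.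
CONDITIONAL on the displayed rows; nothing of Bałaban asserted; N12 NOT discharged; K0⁷ ∕ K1⁹ NOT closed. [cite: Balaban1989LargeFieldI, (0.1)–(0.6) pp.175–176, (1.2) p.178, (1.74) p.192, Prop. 1 (1.77)–(1.78) p.194, (1.79)–(1.80) p.195, (1.89) p.198, (1.91)–(1.97) pp.198–199, (1.99)–(1.102) pp.200–201; Balaban1989LargeFieldII, (1.7)–(1.13) pp.358–359, (17)–(19) pp.360–361; Balaban1988Convergent, (2.1)–(2.9) pp.254–256, (2.17)–(2.18) p.257, (3.16)–(3.25) pp.268–270; Balaban1985Variational, Thm 1 (8) p.279, Prop. 9 (190) p.309; Balaban1987RG1, Thm 1 p.259, (0.20) p.256] -/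
theorem exists_gamma_residW_b15Leaf_window_theta13OfThm1CCMW_pinLF_pinnedΛΩχZ_of_massLive_nearFlatLoc
    (hγ₀ : 0 < γ) (hγh : γ ≤ 1 / 2) (hB : 0 ≤ B₃) (hB' : 0 ≤ B₃') (ha₀ : 0 < a₀) (ha₁ : 0 < a₁)
    {β' : ℝ} (hbox' : BetaUpperH β' γ (betaOfRecord₁₃ F 2 (theta13OfThm1CCMW F 2 j γ ε₀ ε₂₉ B₃ B₃' a₀ a₁))) (hβ' : β' * γ ^ 2 ≤ 3 / 4) (hγe : γ ≤ Real.exp (-3))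
    (D : ∀ P : B12.RunParams, Setting189 (F.P P.K) (SU 2) (MSField (F.P P.K) (SU 2) × ((j : ℕ) → VecField (F.P P.K) j (EuclideanSpace ℝ (Fin (2 ^ 2 - 1))))) (Pt (F.P P.K).d))
    (hD : ∀ P : B12.RunParams, D P = ((({ lam with kSel := fun P : B12.RunParams => P.K - 1, D1100 := fun P : B12.RunParams => rPrimeDataOfSel (reprTOfRecord₁₃ F 2 (theta13OfThm1CCMW F 2 j γ ε₀ ε₂₉ B₃ B₃' a₀ a₁) P (P.K - 1)) ((theta13OfThm1CCMW F 2 j γ ε₀ ε₂₉ B₃ B₃' a₀ a₁).ppSel P (gOfRecord₁₃ F 2 (theta13OfThm1CCMW F 2 j γ ε₀ ε₂₉ B₃ B₃' a₀ a₁) P) (P.K - 1 + 1)) (fibOfSeq F (theta13OfThm1CCMW F 2 j γ ε₀ ε₂₉ B₃ B₃' a₀ a₁).ν (theta13OfThm1CCMW F 2 j γ ε₀ ε₂₉ B₃ B₃' a₀ a₁).τ9 P (gOfRecord₁₃ F 2 (theta13OfThm1CCMW F 2 j γ ε₀ ε₂₉ B₃ B₃' a₀ a₁) P) (P.K - 1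 + 1)) } : ResidW F 2).pinRPrime₁₃ (theta13OfThm1CCMW F 2 j γ ε₀ ε₂₉ B₃ B₃' a₀ a₁)).pinD189ΛH (theta13OfThm1CCMW F 2 j γ ε₀ ε₂₉ B₃ B₃' a₀ a₁).ν (theta13OfThm1CCMW F 2 j γ ε₀ ε₂₉ B₃ B₃' a₀ a₁).A₁ (theta13OfThm1CCMW F 2 j γ ε₀ ε₂₉ B₃ B₃' a₀ a₁).τ9.M (gOfRecord₁₃ F 2 (theta13OfThm1CCMW F 2 j γ ε₀ ε₂₉ B₃ B₃' a₀ a₁)) (fun P => (((((σ P).pinZres (theta13OfThm1CCMW F 2 j γ ε₀ ε₂₉ B₃ B₃' a₀ a₁).ν (theta13OfThm1CCMW F 2 j γ ε₀ ε₂₉ B₃ B₃' a₀ a₁).τ9.M (gOfRecord₁₃ F 2 (theta13OfThm1CCMW F 2 j γ ε₀ ε₂₉ B₃ B₃' a₀ a₁) P) (s P) (N0OfRecord₁₃ (theta13OfThm1CCMW F 2 j γ ε₀ ε₂₉ B₃ B₃' a₀ a₁) P (P.K - 1 + 1))).pinSides (theta13OfThm1CCMW F 2 j γ ε₀ ε₂₉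 B₃ B₃' a₀ a₁).ν (gOfRecord₁₃ F 2 (theta13OfThm1CCMW F 2 j γ ε₀ ε₂₉ B₃ B₃' a₀ a₁) P) (P.K - 1 + 1 - Nm P) (P.K - 1 + 1)).pinXΩ4 (s P) (enlD F (theta13OfThm1CCMW F 2 j γ ε₀ ε₂₉ B₃ B₃' a₀ a₁).ν (theta13OfThm1CCMW F 2 j γ ε₀ ε₂₉ B₃ B₃' a₀ a₁).τ9.M P (gOfRecord₁₃ F 2 (theta13OfThm1CCMW F 2 j γ ε₀ ε₂₉ B₃ B₃' a₀ a₁) P))).pinOmegaPP (s P) (Nm P) (enlD F (theta13OfThm1CCMW F 2 j γ ε₀ ε₂₉ B₃ B₃' a₀ a₁).ν (theta13OfThm1CCMW F 2 j γ ε₀ ε₂₉ B₃ B₃' a₀ a₁).τ9.M P (gOfRecord₁₃ F 2 (theta13OfThm1CCMW F 2 j γ ε₀ ε₂₉ B₃ B₃' a₀ a₁) P)))) s Nm p₁).D189 P)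
    (hmassLive : ∀ P : B12.RunParams, 1 ≤ P.K → Step.InInterval γ P.K (gOfRecord₁₃ F 2 (theta13OfThm1CCMW F 2 j γ ε₀ ε₂₉ B₃ B₃' a₀ a₁) P) → ∀ a, LiveSeq F 2 (theta13OfThm1CCMW F 2 j γ ε₀ ε₂₉ B₃ B₃' a₀ a₁).ν (theta13OfThm1CCMW F 2 j γ ε₀ ε₂₉ B₃ B₃' a₀ a₁).τ9 P (gOfRecord₁₃ F 2 (theta13OfThm1CCMW F 2 j γ ε₀ ε₂₉ B₃ B₃' a₀ a₁) P) (P.K - 1 + 1)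
        (slotsTOfRecord F 2 (theta13OfThm1CCMW F 2 j γ ε₀ ε₂₉ B₃ B₃' a₀ a₁).ν (theta13OfThm1CCMW F 2 j γ ε₀ ε₂₉ B₃ B₃' a₀ a₁).τ9 (EOfRecord₁₃ F 2 (theta13OfThm1CCMW F 2 j γ ε₀ ε₂₉ B₃ B₃' a₀ a₁)) (wOfRecord₉ F 2 (theta13OfThm1CCMW F 2 j γ ε₀ ε₂₉ B₃ B₃' a₀ a₁).toStage9Params)
          (theta13OfThm1CCMW F 2 j γ ε₀ ε₂₉ B₃ B₃' a₀ a₁).ppSel P (gOfRecord₁₃ F 2 (theta13OfThm1CCMW F 2 j γ ε₀ ε₂₉ B₃ B₃' a₀ a₁) P) (P.K - 1 + 1)) a →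
      0 < ∫ V, rterm (reprTOfRecord₁₃ F 2 (theta13OfThm1CCMW F 2 j γ ε₀ ε₂₉ B₃ B₃' a₀ a₁) P (P.K - 1)) a V ∂(fieldMeasure (F.P P.K) (P.K - 1 + 1) (SU 2)))
    (hNN : ∀ P : B12.RunParams, 1 ≤ P.K → Step.InInterval γ P.K (gOfRecord₁₃ F 2 (theta13OfThm1CCMW F 2 j γ ε₀ ε₂₉ B₃ B₃' a₀ a₁) P) → N0OfRecord₁₃ (theta13OfThm1CCMW F 2 j γ ε₀ ε₂₉ B₃ B₃' a₀ a₁) P (P.K - 1 + 1) ≤ Nm P)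
    (hNk : ∀ P : B12.RunParams, 1 ≤ P.K → Step.InInterval γ P.K (gOfRecord₁₃ F 2 (theta13OfThm1CCMW F 2 j γ ε₀ ε₂₉ B₃ B₃' a₀ a₁) P) → N0OfRecord₁₃ (theta13OfThm1CCMW F 2 j γ ε₀ ε₂₉ B₃ B₃' a₀ a₁) P (P.K - 1 + 1) ≤ P.K - 1 + 1)
    (hβ0 : ∀ P : B12.RunParams, 1 ≤ P.K → Step.InInterval γ P.K (gOfRecord₁₃ F 2 (theta13OfThm1CCMW F 2 j γ ε₀ ε₂₉ B₃ B₃' a₀ a₁) P) → 0 ≤ (σ P).β)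
    (hβ : ∀ P : B12.RunParams, 1 ≤ P.K → Step.InInterval γ P.K (gOfRecord₁₃ F 2 (theta13OfThm1CCMW F 2 j γ ε₀ ε₂₉ B₃ B₃' a₀ a₁) P) → (σ P).β ≤ 1 / 4)
    (hL₀ : ∀ P : B12.RunParams, 1 ≤ P.K → Step.InInterval γ P.K (gOfRecord₁₃ F 2 (theta13OfThm1CCMW F 2 j γ ε₀ ε₂₉ B₃ B₃' a₀ a₁) P) → 2 ≤ (σ P).L₀)
    (hL₀L : ∀ P : B12.RunParams, 1 ≤ P.K → Step.InInterval γ P.K (gOfRecord₁₃ F 2 (theta13OfThm1CCMW F 2 j γ ε₀ ε₂₉ B₃ B₃' a₀ a₁) P) → (σ P).L₀ ^ 2 ≤ ((F.P P.K).L : ℝ))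
    (hOB : ∀ P : B12.RunParams, 1 ≤ P.K → Step.InInterval γ P.K (gOfRecord₁₃ F 2 (theta13OfThm1CCMW F 2 j γ ε₀ ε₂₉ B₃ B₃' a₀ a₁) P) → 0 ≤ (σ P).O1 * (σ P).B₃ * (σ P).B₅)
    (hδ : ∀ P : B12.RunParams, 1 ≤ P.K → Step.InInterval γ P.K (gOfRecord₁₃ F 2 (theta13OfThm1CCMW F 2 j γ ε₀ ε₂₉ B₃ B₃' a₀ a₁) P) → 0 ≤ (σ P).δ)
    (hC : ∀ P : B12.RunParams, 1 ≤ P.K → Step.InInterval γ P.K (gOfRecord₁₃ F 2 (theta13OfThm1CCMW F 2 j γ ε₀ ε₂₉ B₃ B₃' a₀ a₁) P) →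
      4 * (2 + (121 / 120) ^ 2 * ((σ P).O1 * (σ P).B₃ * (σ P).B₅ * ((theta13OfThm1CCMW F 2 j γ ε₀ ε₂₉ B₃ B₃' a₀ a₁).τ9.M : ℝ) ^ 5)) ≤ (Real.log (γ ^ 2)⁻¹) ^ (Real.log ((σ P).L₀ ^ 2) / Real.log ((F.P P.K).L : ℝ)))
    (hβhist : ∀ P : B12.RunParams, 1 ≤ P.K → Step.InInterval γ P.K (gOfRecord₁₃ F 2 (theta13OfThm1CCMW F 2 j γ ε₀ ε₂₉ B₃ B₃' a₀ a₁) P) → ∀ i, i < P.K - 1 + 1 → 0 ≤ betaOfRecord₁₃ F 2 (theta13OfThm1CCMW F 2 j γ ε₀ ε₂₉ B₃ B₃' a₀ a₁) i (prefixOf (gOfRecord₁₃ F 2 (theta13OfThm1CCMW F 2 j γ ε₀ ε₂₉ B₃ B₃' a₀ a₁) P) i))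
    (hMl : ∀ P : B12.RunParams, 1 ≤ P.K → Step.InInterval γ P.K (gOfRecord₁₃ F 2 (theta13OfThm1CCMW F 2 j γ ε₀ ε₂₉ B₃ B₃' a₀ a₁) P) → (121 / 120) ^ 2 * ((σ P).O1 * (σ P).B₃ * (σ P).B₅ * ((theta13OfThm1CCMW F 2 j γ ε₀ ε₂₉ B₃ B₃' a₀ a₁).τ9.M : ℝ) ^ 5) * Real.exp (-(4 * (σ P).δ * ((theta13OfThm1CCMW F 2 j γ ε₀ ε₂₉ B₃ B₃' a₀ a₁).τ9.M : ℝ))) ≤ 1 / 12)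
    (hΛ : ∀ P : B12.RunParams, 1 ≤ P.K → Step.InInterval γ P.K (gOfRecord₁₃ F 2 (theta13OfThm1CCMW F 2 j γ ε₀ ε₂₉ B₃ B₃' a₀ a₁) P) → (((enlD F (theta13OfThm1CCMW F 2 j γ ε₀ ε₂₉ B₃ B₃' a₀ a₁).ν (theta13OfThm1CCMW F 2 j γ ε₀ ε₂₉ B₃ B₃' a₀ a₁).τ9.M P (gOfRecord₁₃ F 2 (theta13OfThm1CCMW F 2 j γ ε₀ ε₂₉ B₃ B₃' a₀ a₁) P)) 4 (P.K - 1 + 1 + 1 - (N0OfRecord₁₃ (theta13OfThm1CCMW F 2 j γ ε₀ ε₂₉ B₃ B₃' a₀ a₁) P (P.K - 1 + 1)))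
        (omegaOfChain (s P) (P.K - 1 + 1 + 1 - (N0OfRecord₁₃ (theta13OfThm1CCMW F 2 j γ ε₀ ε₂₉ B₃ B₃' a₀ a₁) P (P.K - 1 + 1)))))ᶜ ∩ (σ P).Z).Nonempty)
    (L91h : ∀ P : B12.RunParams, 1 ≤ P.K → Step.InInterval γ P.K (gOfRecord₁₃ F 2 (theta13OfThm1CCMW F 2 j γ ε₀ ε₂₉ B₃ B₃' a₀ a₁) P) → ∀ U, new189 (D P) U → ∀ p ∈ plaqsOf (half (D P)),
      Ineq191 (dist1 (plaqHol ((D P).Upp U) p)) ((D P).devV'' U p) (D P).α (((D P).L ^ (D P).h)⁻¹) ((D P).ε (D P).h) (E124 (D P).ε (D P).L (D P).η (D P).k (D P).h))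
    (L95 : ∀ P : B12.RunParams, 1 ≤ P.K → Step.InInterval γ P.K (gOfRecord₁₃ F 2 (theta13OfThm1CCMW F 2 j γ ε₀ ε₂₉ B₃ B₃' a₀ a₁) P) → ∀ U, new189 (D P) U → ∀ p ∈ plaqsOf (half (D P)),
      Ineq195 ((D P).devV'' U p) (dist1 (plaqHol ((D P).Uhalf U ((D P).boxOf p)) p)) (D P).α (((D P).L ^ (D P).h)⁻¹) ((D P).ε (D P).h) (E124 (D P).ε (D P).L (D P).η (D P).k (D P).h))
    (L91 : ∀ P : B12.RunParams, 1 ≤ P.K → Step.InInterval γ P.K (gOfRecord₁₃ F 2 (theta13OfThm1CCMW F 2 j γ ε₀ ε₂₉ B₃ B₃' a₀ a₁) P) → ∀ U, new189 (D P) U → ∀ i, (D P).h ≤ i → i ≤ (D P).k → ∀ p ∈ plaqsOf (dom (D P) i),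
      Ineq191 (dist1 (plaqHol ((D P).Upp U) p)) ((D P).dev97 U p) (D P).α (((D P).L ^ i)⁻¹) ((D P).ε i) (E124 (D P).ε (D P).L (D P).η (D P).k i))
    (L97 : ∀ P : B12.RunParams, 1 ≤ P.K → Step.InInterval γ P.K (gOfRecord₁₃ F 2 (theta13OfThm1CCMW F 2 j γ ε₀ ε₂₉ B₃ B₃' a₀ a₁) P) → ∀ U, new189 (D P) U → ∀ i, (D P).h ≤ i → i ≤ (D P).k → ∀ p ∈ plaqsOf (dom (D P) i),
      Ineq191 ((D P).dev97 U p) ((D P).dev0 U p) (D P).α (((D P).L ^ i)⁻¹) ((D P).ε i) (E124 (D P).ε (D P).L (D P).η (D P).k i))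
    (L80 : ∀ P : B12.RunParams, 1 ≤ P.K → Step.InInterval γ P.K (gOfRecord₁₃ F 2 (theta13OfThm1CCMW F 2 j γ ε₀ ε₂₉ B₃ B₃' a₀ a₁) P) → ∀ U, new189 (D P) U → ∀ i, (D P).h ≤ i → i ≤ (D P).k → ∀ p ∈ plaqsOf (dom (D P) i),
      Ineq180 ((D P).dev0 U p) ((D P).ε (D P).k) (D P).η (D P).B₃ (D P).B₅ (D P).M (D P).δ ((D P).dist p) (D P).O1)
    -- dag-n12-c's Proposition-1 instance data ON THE RUN's LATTICE `F.P P.K`, per run `P` and instance `i : ι P` (structural ∕ constants, exactly as in its endpoint of record)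
    (hd3 : ∀ P : B12.RunParams, 3 ≤ (F.P P.K).d) (h0 : ∀ P : B12.RunParams, 0 < (F.P P.K).d) (ι : B12.RunParams → Type)
    [hfin : ∀ P : B12.RunParams, Finite (ι P)]
    -- NO background letters: per instance the class is that of `Z P i`'s OWN maximal sequence `maxDomT (theta13OfThm1CCMW F 2 j γ ε₀ ε₂₉ B₃ B₃' a₀ a₁).ν.M₁ (Z P i)` up to scale `k P i` (dag-n12-c LOCATED-CLASS)
    (Z Λ : ∀ P : B12.RunParams, ι P → Set (Site (F.P P.K) 0))
    (k : ∀ P : B12.RunParams, ι P → ℕ) (M : ∀ P : B12.RunParams, ι P → ℝ) (hk0 : ∀ P i, 0 < k P i) (hk : ∀ P i, k P i ≤ (F.P P.K).m + (F.P P.K).K)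
    (eR : ∀ P : B12.RunParams, ι P → ℝ) (heR : ∀ P i, 0 < eR P i)
    (T : ∀ (P : B12.RunParams) (i : ι P), Finset (PBond (F.P P.K) (k P i)))
    (lo hi : ∀ P : B12.RunParams, ι P → Fin (F.P P.K).d → ℤ) (n : ∀ P : B12.RunParams, ι P → ℕ) (hn : ∀ P i κ, hi P i κ ≤ lo P i κ + n P i)
    (hN : ∀ P i, n P i + 2 < (F.P P.K).sitesPerDir (k P i))
    (hbox : ∀ P i, pts (k P i) (Λ P i) = (castSite '' Set.Icc (lo P i) (hi P i) : Set (Site (F.P P.K) (k P i))))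
    (hZ : ∀ P i, (boxPlaqs (lo P i - 1) (hi P i + 1) : Set (Plaq (F.P P.K) (k P i))) ⊆ plaqsInside (pts (k P i) (Z P i)))
    (hTG0 : ∀ P i, T P i = (box (fun κ => (hi P i κ - lo P i κ + 1).toNat) (lo P i)).image fun x =>
      (⟨castSite (x - unitVec ⟨0, h0 P⟩), ⟨0, h0 P⟩⟩ : PBond (F.P P.K) (k P i)))
    (hN5 : ∀ P i κ, ((hi P i κ - lo P i κ + 1).toNat : ℤ) + 5 < (F.P P.K).sitesPerDir (k P i))
    (Kb : ∀ P : B12.RunParams, ι P → ℕ) (hK1 : ∀ P i, 1 ≤ Kb P i) (hKn : ∀ P i κ, (hi P i κ - lo P i κ + 1).toNat ≤ Kb P i)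
    (ext : ∀ (P : B12.RunParams) (i : ι P), GaugeField (F.P P.K) (k P i) SU2 → GaugeField (F.P P.K) (k P i) SU2)
    (hext : ∀ P i Vk, ext P i Vk = extend (pts (k P i) (Λ P i)) (shellGauge Vk (lo P i) (hi P i)) Vk)
    (hlohi : ∀ P i, lo P i ≤ hi P i)
    {γ₈ bx : B12.RunParams → ℝ} (hγ : ∀ P, 0 < γ₈ P) (hbx : ∀ P, 0 ≤ bx P)
    (hbxM : ∀ P i, 12 * ((F.P P.K).d : ℝ) * ((n P i : ℝ) + 2) ^ 2 ≤ bx P * (M P i) ^ 2)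
    {𝓐₀ : ∀ P : B12.RunParams, ι P → ℝ} (hM : ∀ P i, 1 ≤ M P i)
    {γ₀ : B12.RunParams → ℝ} (hγ₀0 : ∀ P, 0 ≤ γ₀ P)
    -- (J0′) THE INTRINSIC CONFIGURATION LETTER IN THE COMPACTNESS ROUTE's OUTPUT SHAPE (dag-n12-c g17 §4 `hMinC`; produced by dag-n12-w1's `hMin_of_localCharts` ∕ `hMin_of_criticalFamilies`
    -- lineage at `Kc :=` the closed guard): per run and instance, for EVERY COMPACT SET `Kc` of base fields inside the CLOSED small-field guard, ONE radius `R > 0` with the three clauses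
    (hMinC : ∀ P i (Kc : Set (GaugeField (F.P P.K) (k P i) SU2)), IsCompact Kc →
      (∀ Vk ∈ Kc, ∀ p ∈ plaqsInside (pts (k P i) (Z P i ∩ (Λ P i)ᶜ)), dist1 (GaugeField.plaqHol Vk p) ≤ eR P i) →
      ∃ R : ℝ, 0 < R ∧ ∀ Vk ∈ Kc,
      ∃ Ũ : VecField (F.P P.K) (k P i) (EuclideanSpace ℂ (Fin 3)) × VecField (F.P P.K) (k P i) (EuclideanSpace ℂ (Fin 3)) →
          PBond (F.P P.K) 0 → Matrix (Fin 2) (Fin 2) ℂ,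
        (∀ b a c, DifferentiableOn ℂ (fun z => Ũ z b a c) (ball 0 R)) ∧
        (∀ z ∈ ball (0 : VecField (F.P P.K) (k P i) (EuclideanSpace ℂ (Fin 3)) × VecField (F.P P.K) (k P i) (EuclideanSpace ℂ (Fin 3))) R,
          ∀ b a c, ‖Ũ z b a c‖ ≤ 𝓐₀ P i) ∧
        ∀ p B' : VecField (F.P P.K) (k P i) E3, ‖p‖ < R → ‖B'‖ < R → ∃ U' : GaugeField (F.P P.K) 0 SU2,
          (∀ b, Ũ (cplxVec p, cplxVec B') b = ((U' b : SU2) : Matrix (Fin 2) (Fin 2) ℂ)) ∧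
            IsMinimizer (avOfRecord F 2 P.K) (regMSCoPOfRecord F 2 (theta13OfThm1CCMW F 2 j γ ε₀ ε₂₉ B₃ B₃' a₀ a₁).ν P.K (k P i) (maxDomT (theta13OfThm1CCMW F 2 j γ ε₀ ε₂₉ B₃ B₃' a₀ a₁).ν.M₁ (Z P i))) (Bj (theta13OfThm1CCMW F 2 j γ ε₀ ε₂₉ B₃ B₃' a₀ a₁).ν.M₁ (Z P i) (k P i))
              (avgFamily (avOfRecord F 2 P.K) (qsstarGIter0 (k P i) (expMul su2Chart B' (ext P i (expMul su2Chart p Vk))))) U')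
    -- (N) THE NEAR-FLAT LETTER PACKAGE per instance and per base field in the STRICT guard (replaces (L2) `h17`)
    {δc μc ρc δ₂c Kc τc : ∀ P : B12.RunParams, ι P → ℝ} (hδc0 : ∀ P i, 0 ≤ δc P i) (hμc0 : ∀ P i, 0 ≤ μc P i) (hρc0 : ∀ P i, 0 ≤ ρc P i) (hδ₂c0 : ∀ P i, 0 ≤ δ₂c P i)
    (hNF : ∀ P i (Vk : GaugeField (F.P P.K) (k P i) SU2), PlaqSmallOn (plaqsInside (pts (k P i) (Z P i ∩ (Λ P i)ᶜ))) (eR P i) Vk →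
      ∃ (U₀ : GaugeField (F.P P.K) 0 SU2) (Xf : GaugeSlice (pts (k P i) (Λ P i)) (T P i) E3 → PBond (F.P P.K) 0 → lieSU (Fin 2)),
        (∀ p : Plaq (F.P P.K) 0, ((⟨p.src, p.μ⟩ : PBond (F.P P.K) 0) ∈ {b : PBond (F.P P.K) 0 | b.src ∈ maxDomT (theta13OfThm1CCMW F 2 j γ ε₀ ε₂₉ B₃ B₃' a₀ a₁).ν.M₁ (Z P i) 1} ∨
            (⟨p.src.shift p.μ, p.ν⟩ : PBond (F.P P.K) 0) ∈ {b : PBond (F.P P.K) 0 | b.src ∈ maxDomT (theta13OfThm1CCMW F 2 j γ ε₀ ε₂₉ B₃ B₃' a₀ a₁).ν.M₁ (Z P i) 1} ∨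
            (⟨p.src.shift p.ν, p.μ⟩ : PBond (F.P P.K) 0) ∈ {b : PBond (F.P P.K) 0 | b.src ∈ maxDomT (theta13OfThm1CCMW F 2 j γ ε₀ ε₂₉ B₃ B₃' a₀ a₁).ν.M₁ (Z P i) 1} ∨
            (⟨p.src, p.ν⟩ : PBond (F.P P.K) 0) ∈ {b : PBond (F.P P.K) 0 | b.src ∈ maxDomT (theta13OfThm1CCMW F 2 j γ ε₀ ε₂₉ B₃ B₃' a₀ a₁).ν.M₁ (Z P i) 1}) →
          ‖((U₀ ⟨p.src, p.μ⟩ : SU2) : Matrix (Fin 2) (Fin 2) ℂ) - 1‖ ≤ δc P i ∧ ‖((U₀ ⟨p.src.shift p.μ, p.ν⟩ : SU2) : Matrix (Fin 2) (Fin 2) ℂ) - 1‖ ≤ δc P i ∧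
            ‖((U₀ ⟨p.src.shift p.ν, p.μ⟩ : SU2) : Matrix (Fin 2) (Fin 2) ℂ) - 1‖ ≤ δc P i ∧ ‖((U₀ ⟨p.src, p.ν⟩ : SU2) : Matrix (Fin 2) (Fin 2) ℂ) - 1‖ ≤ δc P i) ∧
        Xf 0 = 0 ∧ ContDiffAt ℝ 2 Xf 0 ∧
        (∀ᶠ Y in 𝓝 (0 : GaugeSlice (pts (k P i) (Λ P i)) (T P i) E3),
          IsMinimizer (Node00.avOfRecord F 2 P.K) (Node00.regMSCoPOfRecord F 2 (theta13OfThm1CCMW F 2 j γ ε₀ ε₂₉ B₃ B₃' a₀ a₁).ν P.K (k P i) (maxDomT (theta13OfThm1CCMW F 2 j γ ε₀ ε₂₉ B₃ B₃' a₀ a₁).ν.M₁ (Z P i))) (Bj (theta13OfThm1CCMW F 2 j γ ε₀ ε₂₉ B₃ B₃' a₀ a₁).ν.M₁ (Z P i) (k P i))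
            (avgFamily (Node00.avOfRecord F 2 P.K) (qsstarGIter0 (k P i) (expMul su2Chart (ιA (pts (k P i) (Λ P i)) (T P i) Y) (ext P i Vk)))) (expChart U₀ (Xf Y))) ∧
        ∃ (Ψ₂ : (PBond (F.P P.K) 0 → lieSU (Fin 2)) →L[ℝ] (PBond (F.P P.K) 0 → lieSU (Fin 2)) →L[ℝ] (Fin (constrCard (Bj (theta13OfThm1CCMW F 2 j γ ε₀ ε₂₉ B₃ B₃' a₀ a₁).ν.M₁ (Z P i) (k P i)) (k P i)) → lieSU (Fin 2)))
          (lam : (Fin (constrCard (Bj (theta13OfThm1CCMW F 2 j γ ε₀ ε₂₉ B₃ B₃' a₀ a₁).ν.M₁ (Z P i) (k P i)) (k P i)) → lieSU (Fin 2)) →L[ℝ] ℝ)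
          (p : Seminorm ℝ (PBond (F.P P.K) 0 → lieSU (Fin 2))) (q : (Fin (constrCard (Bj (theta13OfThm1CCMW F 2 j γ ε₀ ε₂₉ B₃ B₃' a₀ a₁).ν.M₁ (Z P i) (k P i)) (k P i)) → lieSU (Fin 2)) → ℝ)
          (Lf : (PBond (F.P P.K) 0 → lieSU (Fin 2)) →L[ℝ] (Fin (constrCard (Bj (theta13OfThm1CCMW F 2 j γ ε₀ ε₂₉ B₃ B₃' a₀ a₁).ν.M₁ (Z P i) (k P i)) (k P i)) → lieSU (Fin 2)))
          (Rf : (Fin (constrCard (Bj (theta13OfThm1CCMW F 2 j γ ε₀ ε₂₉ B₃ B₃' a₀ a₁).ν.M₁ (Z P i) (k P i)) (k P i)) → lieSU (Fin 2)) → PBond (F.P P.K) 0 → lieSU (Fin 2)),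
          HasFDerivAt (fun Y => fderiv ℝ (msChart F 2 P.K (k P i) (Bj (theta13OfThm1CCMW F 2 j γ ε₀ ε₂₉ B₃ B₃' a₀ a₁).ν.M₁ (Z P i) (k P i)) (avgFamily (Node00.avOfRecord F 2 P.K) (qsstarGIter0 (k P i) (ext P i Vk))) U₀) Y) Ψ₂ 0 ∧
          (∀ᶠ Y in 𝓝 (0 : PBond (F.P P.K) 0 → lieSU (Fin 2)),
            DifferentiableAt ℝ (msChart F 2 P.K (k P i) (Bj (theta13OfThm1CCMW F 2 j γ ε₀ ε₂₉ B₃ B₃' a₀ a₁).ν.M₁ (Z P i) (k P i)) (avgFamily (Node00.avOfRecord F 2 P.K) (qsstarGIter0 (k P i) (ext P i Vk))) U₀) Y) ∧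
          fderiv ℝ (fun Y : PBond (F.P P.K) 0 → lieSU (Fin 2) => wilsonAction4 (expChart U₀ Y)) 0 =
            lam.comp (fderiv ℝ (msChart F 2 P.K (k P i) (Bj (theta13OfThm1CCMW F 2 j γ ε₀ ε₂₉ B₃ B₃' a₀ a₁).ν.M₁ (Z P i) (k P i)) (avgFamily (Node00.avOfRecord F 2 P.K) (qsstarGIter0 (k P i) (ext P i Vk))) U₀) 0) ∧
          (∀ Y : PBond (F.P P.K) 0 → lieSU (Fin 2), ∑ b, ‖(Y b : Matrix (Fin 2) (Fin 2) ℂ)‖ ^ 2 ≤ p Y ^ 2) ∧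
          (∀ v, Lf (Rf v) = v) ∧ (∀ v, p (Rf v) ≤ ρc P i * q v) ∧
          ∀ X : GaugeSlice (pts (k P i) (Λ P i)) (T P i) E3,
            q (fderiv ℝ (msChart F 2 P.K (k P i) (Bj (theta13OfThm1CCMW F 2 j γ ε₀ ε₂₉ B₃ B₃' a₀ a₁).ν.M₁ (Z P i) (k P i)) (avgFamily (Node00.avOfRecord F 2 P.K) (qsstarGIter0 (k P i) (ext P i Vk))) U₀) 0 (fderiv ℝ Xf 0 X)
                - Lf (fderiv ℝ Xf 0 X)) ≤ δ₂c P i * p (fderiv ℝ Xf 0 X) ∧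
            lam (Ψ₂ (fderiv ℝ Xf 0 X) (fderiv ℝ Xf 0 X)) ≤ μc P i * p (fderiv ℝ Xf 0 X) ^ 2 ∧
            p (fderiv ℝ Xf 0 X) ≤ Kc P i * ‖X‖ ∧
            ∃ m : ℝ, (∀ w', Lf w' = fderiv ℝ (msChart F 2 P.K (k P i) (Bj (theta13OfThm1CCMW F 2 j γ ε₀ ε₂₉ B₃ B₃' a₀ a₁).ν.M₁ (Z P i) (k P i)) (avgFamily (Node00.avOfRecord F 2 P.K) (qsstarGIter0 (k P i) (ext P i Vk))) U₀) 0
                  (fderiv ℝ Xf 0 X) →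
                m ≤ fderiv ℝ (fun Y => fderiv ℝ (fun Y : PBond (F.P P.K) 0 → lieSU (Fin 2) => wilsonAction4 (expChart (1 : GaugeField (F.P P.K) 0 SU2) Y)) Y) 0 w' w') ∧
              γ₀ P * (∑ z ∈ box (fun κ => (hi P i κ - lo P i κ + 1).toNat + 3) (fun κ => lo P i κ - 2), ∑ μ : Fin (F.P P.K).d, ∑ a : Fin 3,
                  curl (fun b => ιA (pts (k P i) (Λ P i)) (T P i) X (⟨castSite b.1, b.2⟩ : PBond (F.P P.K) (k P i)) a) z ⟨0, h0 P⟩ μ ^ 2) - τc P i * ‖X‖ ^ 2 ≤ m)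
    -- numerics: the assembled `Cerr i` (with the twist defect `τc P i`) is small, and the positivity constant fits
    (hsm : ∀ P i, (32 * (((F.P P.K).d : ℝ) - 1) * δc P i + μc P i + 16 * (((F.P P.K).d : ℝ) - 1) * (ρc P i * δ₂c P i) * (2 + ρc P i * δ₂c P i)) * Kc P i ^ 2 + τc P i
      ≤ γ₀ P / (2 * (3 * (Kb P i : ℝ) ^ 2 + 2 * (Kb P i : ℝ) ^ 4)))
    (hγle : ∀ P i, γ₈ P / (M P i) ^ 5 ≤ γ₀ P / (2 * (3 * (Kb P i : ℝ) ^ 2 + 2 * (Kb P i : ℝ) ^ 4)))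
    -- the geometric letter: every fine site whose k-block label lies in the box `[lo − 1, hi + 1]` lies in `Ω₁(Z)` (print: `Λ` deep inside `Z`); dag-n12-c's `far_letter_of_box` turns it into the bond letter `hfar`
    (hZ1 : ∀ P i (y : Site (F.P P.K) 0), B14.Eq22Determines.blockIter (k P i) y ∈ (castSite '' Set.Icc (lo P i - 1) (hi P i + 1) : Set (Site (F.P P.K) (k P i))) → y ∈ maxDomT (theta13OfThm1CCMW F 2 j γ ε₀ ε₂₉ B₃ B₃' a₀ a₁).ν.M₁ (Z P i) 1)
    -- (Gᵃ) `Z` a union of `k`-blocks (print's `Z` is a union of `M`-cubes of `T₁^{(k)}`)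
    (hZblk : ∀ P i, B14.Eq22Determines.IsBlockUnion (k P i) (Z P i))
    -- (Gᵇ) DISCHARGED (dag-n12-c §8): print's `M₁ ≥ 2` and, per instance, the torus divisibility `L^{k}·M₁ ∣ 2L^{m+K}` of the `LʲM₁`-cube partitions
    (hdiv : ∀ P i, B14.Eq213MaximalDomains.side (F.P P.K).L (theta13OfThm1CCMW F 2 j γ ε₀ ε₂₉ B₃ B₃' a₀ a₁).ν.M₁ (k P i) ∣ (F.P P.K).sitesPerDir 0)
    -- bookkeeping constants: `c_E`, `c_A` per run; `B₃`, `a₀`, `a₁'` = THE [15] THEOREM-1 CONSTANTS OF (8) (one triple for all runs and instances)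
    {cE cA : B12.RunParams → ℝ} (hcE0 : ∀ P, 0 ≤ cE P) (hcE : ∀ P i, 12 * ((F.P P.K).d : ℝ) * ((n P i : ℝ) + 2) ^ 2 ≤ cE P)
    (heRa : ∀ P i, (cE P + 1) * eR P i ≤ a₁ ∧ B₃ * ((cE P + 1) * eR P i) ≤ (theta13OfThm1CCMW F 2 j γ ε₀ ε₂₉ B₃ B₃' a₀ a₁).ν.εreg)
    (hcA : ∀ P, 1 / 2 * (B₃ * (cE P + 1) * (F.P P.K).eta 1 ^ 2) ^ 2 * (Fintype.card (Plaq (F.P P.K) 0) : ℝ) ≤ cA P)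
    -- ONE MORE of dag-n24-c's door letters: [15] Thm 1's regularity sentence `h15` (⟸ K0⁷ stub 1's (8) top step, dag-n07-e) — its `(B₃, a₀, a₁)` ARE the [15] constants of the bookkeeping
    -- above (the witness's `εreg = a₀`, `rfl`; the sign `0 ≤ B₃` is `hB` above); and the cube letter is POSITIVE, `1 ≤ j` (print's `M₁ = L^j ≥ 2`; the V19 cube letter is `j = ρ₀ + 3`)
    (h15 : VariationalThm1RegSepCoP7M F 2 B₃ a₀ a₁) (hj : 1 ≤ j) :
    ∃ γ₁₂ : ℝ, 0 < γ₁₂ ∧ ∃ lamW : ResidW F 2, ∀ P : B12.RunParams, lamW.kSel P < P.K → Step.InInterval γ₁₂ P.K (gOfRecord₁₃ F 2 (theta13OfThm1CCMW F 2 j γ ε₀ ε₂₉ B₃ B₃' a₀ a₁) P) →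
        B15Leaf (WOfRecord₁₃ F 2 (theta13OfThm1CCMW F 2 j γ ε₀ ε₂₉ B₃ B₃' a₀ a₁) lamW P) := by
  -- `2 ≤ M₁ = L^j` at the window-edition witness (`1 ≤ j`, `1 < L`; `ν` is the collared member's, `rfl`); `εreg = a₀` (`rfl`)
  have h2 : 2 ≤ F.L ^ j :=
    calc 2 ≤ F.L := F.hL.2
      _ = F.L ^ 1 := (pow_one _).symm
      _ ≤ F.L ^ j := Nat.pow_le_pow_right (Nat.zero_lt_of_lt F.hL.2) hj
  -- Prop. 1 at the pinned carrier, run by run: dag-n12-c's J-C v1.2 endpoint (12Q⁸ §1's call at `ν := θW.ν`); radii and thresholds PRODUCED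
  choose R hR areg ha hP using fun P : B12.RunParams =>
    exists_domain_prop1Printed_lfVarOn_std_su2_box_intrinsic_analytic_atZSeqCoPRecord_ofThm1TorusClass_ofMinimiserFamilyCompact_ofNearFlatLetters_sub_loc_oneSided (F := F) (theta13OfThm1CCMW F 2 j γ ε₀ ε₂₉ B₃ B₃' a₀ a₁).ν P.K (hd3 P) (h0 P)
      (Z := Z P) (Λ := Λ P) (k := k P) (M := M P) (hk0 := hk0 P) (hk := hk P) (eR := eR P) (heR := heR P) (T := T P) (lo := lo P) (hi := hi P) (n := n P) (hn := hn P)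
      (hN := hN P) (hbox := hbox P) (hZ := hZ P) (hTG0 := hTG0 P) (hN5 := hN5 P) (K := Kb P) (hK1 := hK1 P) (hKn := hKn P) (ext := ext P) (hext := hext P) (hlohi := hlohi P)
      (hγ := hγ P) (hbx := hbx P) (hbxM := hbxM P) (hM := hM P) (hγ₀ := hγ₀0 P) (hMinC := hMinC P) (hδc0 := hδc0 P) (hμc0 := hμc0 P) (hρc0 := hρc0 P) (hδ₂c0 := hδ₂c0 P) (hNF := hNF P)
      (hsm := hsm P) (hγle := hγle P) (hfar := fun i b hb => far_letter_of_box (hbox P i) (hZ1 P i) b hb) (hZblk := hZblk P) (hM2 := h2) (hdiv := hdiv P)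
      (hcE0 := hcE0 P) (hcE := hcE P) (hB₃ := hB) (heRa := heRa P) (ha₀ := le_of_eq rfl) (hcA := hcA P)
      (h15T := thm1TorusClass_of_variationalThm1RegSepCoP7M (theta13OfThm1CCMW F 2 j γ ε₀ ε₂₉ B₃ B₃' a₀ a₁).ν P.K h15)
  -- 12Zᴳ-W §2 at the LF-pinned base layer, its Prop-1 row fed
  exact exists_gamma_residW_b15Leaf_window_theta13OfThm1CCMW_topLevel_pinnedΛΩχZ_of_massLive
    { lam with LF := fun P => lfVarOn su2Chart fun i => InstOn.std (bgMSCoPOfRecord F 2 (theta13OfThm1CCMW F 2 j γ ε₀ ε₂₉ B₃ B₃' a₀ a₁).ν P.K (k P i) (maxDomT (theta13OfThm1CCMW F 2 j γ ε₀ ε₂₉ B₃ B₃' a₀ a₁).ν.M₁ (Z P i))) (theta13OfThm1CCMW F 2 j γ ε₀ ε₂₉ B₃ B₃' a₀ a₁).ν.M₁ (Z P i) (Λ P i) (k P i) (M P i) (areg P i)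
                            (anExt (pts (k P i) (Λ P i)) (T P i) (fun177std (bgMSCoPOfRecord F 2 (theta13OfThm1CCMW F 2 j γ ε₀ ε₂₉ B₃ B₃' a₀ a₁).ν P.K (k P i) (maxDomT (theta13OfThm1CCMW F 2 j γ ε₀ ε₂₉ B₃ B₃' a₀ a₁).ν.M₁ (Z P i))) (theta13OfThm1CCMW F 2 j γ ε₀ ε₂₉ B₃ B₃' a₀ a₁).ν.M₁ (Z P i) (k P i)) (ext P i)
                              (min (1 / 2) (min (R P i / 8) (γ₈ P / (M P i) ^ 5 * (R P i / 2) ^ 2 /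
                                (48 * (4 * ((Fintype.card (Plaq (F.P P.K) 0) : ℝ) * (1 + 8 * 𝓐₀ P i ^ 4)) / R P i + 1)))))) }
    σ s Nm p₁ hγ₀ hγh hB hB' ha₀ ha₁ hbox' hβ' hγe D hD hmassLive (fun P _ _ => hP P) hNN hNk hβ0 hβ hL₀ hL₀L hOB hδ hC hβhist hMl hΛ L91h L95 L91 L97 L80

end PinLF

end Summit.QuantumFields.YangMills.BalabanUVNodes.N12AtTheta13OfThm1CCMWGenericDoorWindowGuardPinLF

end
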